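import Summits.QuantumFields.BalabanUV.Beta.GAN24.DirichletExhaustionDeperiodise
import Summits.QuantumFields.BalabanUV.Beta.FP.DeperiodisationVanishing

/-!
# `BalabanUV.Beta.FP.KernelLawDeperiodised` — road «FP» for binder row D1, ROUTE T, memo `N2B-DESIGN.md` §30 (30e): **A THREE-KERNEL LAW WHOSE TORUS VALUES ARE
# PERIODISATIONS UP TO A VANISHING WRAP-AROUND DE-PERIODISES ENTRYWISE** — the last [folklore] brick between the kernel door on every torus (#20
# `SecondVarKernelLaw`, #22 `GradedPackedHess`, (B2)) and the END's entrywise `hfin` (`StepDefectInherit.stepDefect_inherit`)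

WHAT.  After (J-b) and (B2) the (STEP) door on the torus `M_k` reads, at a bond pair with lattice representative `z`, `K_N(k) = K_F(k) + K_G(k)` where each torus
kernel is the periodisation of an exponentially bounded LATTICE kernel up to a wrap-around: `K_X(k) − Σ'_m 𝒦_X (z + M_k∘m) → 0` ((P2)
`KernelPeriodisationFibTrace.trace_perF_dper ∕ abs_trace_perF_dper_sub_tr_le`: the `m′ ≠ 0` shifted-diagonal traces are exponentially small in `min_i M_k i`).
This file: §0 `law_of_tendsto ∕ law_of_tendsto_sub` — the POINTWISE route (torus kernels converging to lattice kernels at fixed bonds, e.g. by (P2)'s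
wrap-around bounds directly; uniqueness of limits, nothing else); §1 `tendsto_tsum_translate_of_expBound` — the periodisations of an exponentially bounded lattice function along boxes `M_k` with `min_i M_k i → ∞`
tend to its value (gan24-p2's tail bound `DirichletExhaustionDeperiodise.abs_tsum_translate_sub_le` + `tendsto_exp_tail` BY NAME); `tendsto_of_sub_tsum_translate`
— a torus quantity within `o(1)` of the periodisation tends to the lattice value; §2 **`kernel_law_deperiodised`** — three lattice kernels, three torus
sequences within `o(1)` of their periodisations, the law on every torus ⟹ `𝒦_N z = 𝒦_F z + 𝒦_G z`; `kernel_law_deperiodised_of_eq` — the exact case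
(torus value = periodisation; then gan24-p2's `eq_of_tsum_translate_eq` shape); §3 `kernel_law_deperiodised_smul` — the Summable-only twin along CUBIC
periods `z + M•t` over the road's `DeperiodisationVanishing.tendsto_tsum_translate_smul` (gen 16).  No `def`, no `def … : Prop`, nothing cited, 0 sorry; the
only analysis is the comparison of limits (`tendsto_nhds_unique`).

HONEST DEPENDENCY (page 1, mandatory): continuum YM on T⁴ ⇐ BetaPertH ∧ nine spine estimates (0/9 proved); BetaPertH ⇐ (D1) ∧ (D4) ∧ CAP+tail;
G-an2-4 gates asym, D1 and NE2/3/4.  HONEST FRAMING (cell contract, verbatim): «discharging `BetaPertH` makes Bałaban's UV stability UNCONDITIONAL —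
a real constructive-QFT result; it is NOT the continuum limit and NOT the Clay problem.»  ABSOLUTE RULE (cell charter, verbatim): «No internally-minted
statement may enter as a cited fact. Every hypothesis is either kernel-proved in this package or a verbatim quotation of a PUBLISHED theorem with page
reference. The manuscript(s) under audit are NOT citable for their own disputed steps — they are the thing under adjudication; programme-internal
(2001/route/tribunal) claims are never citable.»  [folklore]; nothing of Bałaban's asserted; 0 estimates beyond the cited tail bound; 0∕4 row-D1 binders;
NOT (T-ID), NOT SDF, NOT D1, NOT BetaPertH, NOT continuum, NOT Clay.  Road «FP» OWNER, b2b-balaban-beta-d1-p3 gen 21, 2026-08-22.  No existing file touched.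
-/

noncomputable section

namespace Summit.QuantumFields.BalabanUV.Beta.FP.KernelLawDeperiodised

open Filter Topology
open scoped BigOperators
open Literature.MathematicalPhysics.QuantumFieldTheory.Balaban1983to89
open B4Sect5Proof (latticeConst latticeConst_nonneg)
open B4TorusKernel.MultiPeriod (translate)
open Summit.QuantumFields.BalabanUV.Beta.GAN24.DirichletExhaustionDeperiodise (abs_tsum_translate_sub_le tendsto_exp_tail)
open Summit.QuantumFields.BalabanUV.Beta.FP.DeperiodisationVanishing (tendsto_tsum_translate_smul)

variable {d : ℕ}

/-! ## §0 The pointwise route: torus kernels converging to lattice kernels -/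

section Pointwise

/-- [folklore] **A THREE-KERNEL LAW ON EVERY TORUS PASSES TO POINTWISE LIMITS**: if the three torus sequences converge (`K_X(k) → 𝒦_X`, e.g. by (P2)'s
wrap-around bounds `KernelPeriodisationFibTrace.abs_trace_perF_dper_sub_tr_le` ∕ `…TraceRel.abs_tr_comp_dper_sub_le` at FIXED lattice bonds as the torus
grows) and `K_N(k) = K_F(k) + K_G(k)` for every `k`, then `𝒦_N = 𝒦_F + 𝒦_G` (uniqueness of limits; no summability needed). -/
theorem law_of_tendsto {KN KF KG : ℕ → ℝ} {cN cF cG : ℝ} (hN : Tendsto KN atTop (𝓝 cN)) (hF : Tendsto KF atTop (𝓝 cF))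
    (hG : Tendsto KG atTop (𝓝 cG)) (hlaw : ∀ k, KN k = KF k + KG k) : cN = cF + cG :=
  tendsto_nhds_unique hN ((hF.add hG).congr fun k => by simp only [hlaw k])

/-- [folklore] The same with the torus values given within `o(1)` of arbitrary convergent comparison sequences (`K_X(k) − P_X(k) → 0`, `P_X(k) → 𝒦_X`). -/
theorem law_of_tendsto_sub {KN KF KG PN PF PG : ℕ → ℝ} {cN cF cG : ℝ}
    (hN : Tendsto (fun k => KN k - PN k) atTop (𝓝 0)) (hPN : Tendsto PN atTop (𝓝 cN))
    (hF : Tendsto (fun k => KF k - PF k) atTop (𝓝 0)) (hPF : Tendsto PF atTop (𝓝 cF))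
    (hG : Tendsto (fun k => KG k - PG k) atTop (𝓝 0)) (hPG : Tendsto PG atTop (𝓝 cG))
    (hlaw : ∀ k, KN k = KF k + KG k) : cN = cF + cG := by
  have e : ∀ {K P : ℕ → ℝ} {c : ℝ}, Tendsto (fun k => K k - P k) atTop (𝓝 0) → Tendsto P atTop (𝓝 c) → Tendsto K atTop (𝓝 c) := by
    intro K P c h1 h2
    have h := h1.add h2
    simp only [sub_add_cancel, zero_add] at h
    exact h
  exact law_of_tendsto (e hN hPN) (e hF hPF) (e hG hPG) hlaw

end Pointwise

/-! ## §1 Periodisations along growing boxes tend to the lattice value -/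

section Boxes

variable {f : (Fin (d + 1) → ℤ) → ℝ} {C a : ℝ} {x₀ : Fin (d + 1) → ℤ}

/-- [folklore] **THE PERIODISATIONS OF AN EXPONENTIALLY BOUNDED LATTICE FUNCTION ALONG GROWING BOXES TEND TO ITS VALUE**: if `|f z| ≤ C·e^{−a·dist x₀ z}` and the
boxes `M_k` satisfy `∀ N, eventually ∀ i, N ≤ M_k i`, then `Σ'_m f (z + M_k∘m) → f z`. -/
theorem tendsto_tsum_translate_of_expBound (ha : 0 < a) (hC : 0 ≤ C) (hf : ∀ z, |f z| ≤ C * Real.exp (-(a * dist x₀ z)))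
    {M : ℕ → (Fin (d + 1) → ℕ)} (hM : ∀ N : ℕ, ∀ᶠ k in atTop, ∀ i, N ≤ M k i) (z : Fin (d + 1) → ℤ) :
    Tendsto (fun k => ∑' m : Fin (d + 1) → ℤ, f (translate (M k) z m)) atTop (𝓝 (f z)) := by
  set B := C * latticeConst (d + 1) a * Real.exp (a * dist x₀ z) with hB
  rw [Metric.tendsto_atTop]
  intro ε hε
  -- choose `N` with the tail rate below `ε`, then `k₀` beyond which every side of `M_k` is `≥ N`
  have htail : Tendsto (fun N : ℕ => B * Real.exp (-(a * ((N : ℝ) - 1)))) atTop (𝓝 0) := by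
    simpa using (tendsto_exp_tail ha).const_mul B
  obtain ⟨N₀, hN₀⟩ := (Metric.tendsto_atTop.1 htail) ε hε
  obtain ⟨k₀, hk₀⟩ := Filter.eventually_atTop.1 (hM (max N₀ 1))
  refine ⟨k₀, fun k hk => ?_⟩
  have hMN : ∀ i, max N₀ 1 ≤ M k i := hk₀ k hk
  have h1 := abs_tsum_translate_sub_le ha hC hf (le_max_right N₀ 1) hMN z
  have h2 := hN₀ (max N₀ 1) (le_max_left _ _)
  rw [Real.dist_eq, sub_zero, abs_of_nonneg] at h2
  · rw [Real.dist_eq]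
    exact lt_of_le_of_lt h1 h2
  · exact mul_nonneg (mul_nonneg (mul_nonneg hC (latticeConst_nonneg (d + 1) ha.le)) (Real.exp_pos _).le) (Real.exp_pos _).le

/-- [folklore] **A TORUS QUANTITY WITHIN `o(1)` OF THE PERIODISATION TENDS TO THE LATTICE VALUE**: if `K k − Σ'_m f (z + M_k∘m) → 0` then `K k → f z`. -/
theorem tendsto_of_sub_tsum_translate (ha : 0 < a) (hC : 0 ≤ C) (hf : ∀ z, |f z| ≤ C * Real.exp (-(a * dist x₀ z)))
    {M : ℕ → (Fin (d + 1) → ℕ)} (hM : ∀ N : ℕ, ∀ᶠ k in atTop, ∀ i, N ≤ M k i) (z : Fin (d + 1) → ℤ) {K : ℕ → ℝ}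
    (hK : Tendsto (fun k => K k - ∑' m : Fin (d + 1) → ℤ, f (translate (M k) z m)) atTop (𝓝 0)) :
    Tendsto K atTop (𝓝 (f z)) := by
  have h := hK.add (tendsto_tsum_translate_of_expBound ha hC hf hM z)
  simp only [sub_add_cancel, zero_add] at h
  exact h

end Boxes

/-! ## §2 The three-kernel law de-periodises -/

section Law

variable {fN fF fG : (Fin (d + 1) → ℤ) → ℝ} {CN aN CF aF CG aG : ℝ} {xN xF xG : Fin (d + 1) → ℤ}

/-- [folklore] **A THREE-KERNEL LAW WHOSE TORUS VALUES ARE PERIODISATIONS UP TO A VANISHING WRAP-AROUND DE-PERIODISES ENTRYWISE.**  Three exponentially bounded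
lattice kernels `𝒦_N, 𝒦_F, 𝒦_G` (read at a fixed pair of colour ∕ bond indices: real functions on `ℤ^{d+1}`), boxes `M_k` with `min_i M_k i → ∞`, and for a fixed
lattice point `z` three torus sequences `K_N(k), K_F(k), K_G(k)` with `K_X(k) − Σ'_m 𝒦_X (z + M_k∘m) → 0`; if `K_N(k) = K_F(k) + K_G(k)` for every `k` (the kernel
door on every torus), then `𝒦_N z = 𝒦_F z + 𝒦_G z` — the END's entrywise identity at this `z`. -/
theorem kernel_law_deperiodised
    (haN : 0 < aN) (hCN : 0 ≤ CN) (hfN : ∀ z, |fN z| ≤ CN * Real.exp (-(aN * dist xN z)))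
    (haF : 0 < aF) (hCF : 0 ≤ CF) (hfF : ∀ z, |fF z| ≤ CF * Real.exp (-(aF * dist xF z)))
    (haG : 0 < aG) (hCG : 0 ≤ CG) (hfG : ∀ z, |fG z| ≤ CG * Real.exp (-(aG * dist xG z)))
    {M : ℕ → (Fin (d + 1) → ℕ)} (hM : ∀ N : ℕ, ∀ᶠ k in atTop, ∀ i, N ≤ M k i) (z : Fin (d + 1) → ℤ) {KN KF KG : ℕ → ℝ}
    (hKN : Tendsto (fun k => KN k - ∑' m : Fin (d + 1) → ℤ, fN (translate (M k) z m)) atTop (𝓝 0))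
    (hKF : Tendsto (fun k => KF k - ∑' m : Fin (d + 1) → ℤ, fF (translate (M k) z m)) atTop (𝓝 0))
    (hKG : Tendsto (fun k => KG k - ∑' m : Fin (d + 1) → ℤ, fG (translate (M k) z m)) atTop (𝓝 0))
    (hlaw : ∀ k, KN k = KF k + KG k) :
    fN z = fF z + fG z := by
  have hN := tendsto_of_sub_tsum_translate haN hCN hfN hM z hKN
  have hFG := (tendsto_of_sub_tsum_translate haF hCF hfF hM z hKF).add (tendsto_of_sub_tsum_translate haG hCG hfG hM z hKG)
  have hN' : Tendsto KN atTop (𝓝 (fF z + fG z)) := by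
    refine hFG.congr fun k => ?_
    simp only [hlaw k]
  exact tendsto_nhds_unique hN hN'

/-- [folklore] THE EXACT CASE: if each torus value IS the periodisation (`K_X(k) = Σ'_m 𝒦_X (z + M_k∘m)`), the law on every torus de-periodises. -/
theorem kernel_law_deperiodised_of_eq
    (haN : 0 < aN) (hCN : 0 ≤ CN) (hfN : ∀ z, |fN z| ≤ CN * Real.exp (-(aN * dist xN z)))
    (haF : 0 < aF) (hCF : 0 ≤ CF) (hfF : ∀ z, |fF z| ≤ CF * Real.exp (-(aF * dist xF z)))
    (haG : 0 < aG) (hCG : 0 ≤ CG) (hfG : ∀ z, |fG z| ≤ CG * Real.exp (-(aG * dist xG z)))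
    {M : ℕ → (Fin (d + 1) → ℕ)} (hM : ∀ N : ℕ, ∀ᶠ k in atTop, ∀ i, N ≤ M k i) (z : Fin (d + 1) → ℤ)
    (hlaw : ∀ k, ∑' m : Fin (d + 1) → ℤ, fN (translate (M k) z m)
      = (∑' m : Fin (d + 1) → ℤ, fF (translate (M k) z m)) + ∑' m : Fin (d + 1) → ℤ, fG (translate (M k) z m)) :
    fN z = fF z + fG z :=
  kernel_law_deperiodised haN hCN hfN haF hCF hfF haG hCG hfG hM z
    (by simp only [sub_self]; exact tendsto_const_nhds) (by simp only [sub_self]; exact tendsto_const_nhds)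
    (by simp only [sub_self]; exact tendsto_const_nhds) hlaw

end Law

/-! ## §3 Summable-only twin along cubic periods -/

section Cubic

variable {fN fF fG : (Fin (d + 1) → ℤ) → ℝ}

/-- [folklore] **CUBIC PERIODS, SUMMABILITY ONLY**: three SUMMABLE lattice kernels, torus sequences along the cubic periods `z + M•t` (`M → ∞` through a
sequence `M_k → ∞`) within `o(1)` of the periodisations, the law on every torus ⟹ `𝒦_N z = 𝒦_F z + 𝒦_G z` (the road's gen-16
`DeperiodisationVanishing.tendsto_tsum_translate_smul` BY NAME; no decay rate needed when the wrap-around letters are supplied as `o(1)` directly). -/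
theorem kernel_law_deperiodised_smul (hfN : Summable fN) (hfF : Summable fF) (hfG : Summable fG)
    {M : ℕ → ℕ} (hM : Tendsto M atTop atTop) (z : Fin (d + 1) → ℤ) {KN KF KG : ℕ → ℝ}
    (hKN : Tendsto (fun k => KN k - ∑' t : Fin (d + 1) → ℤ, fN (z + (M k : ℤ) • t)) atTop (𝓝 0))
    (hKF : Tendsto (fun k => KF k - ∑' t : Fin (d + 1) → ℤ, fF (z + (M k : ℤ) • t)) atTop (𝓝 0))
    (hKG : Tendsto (fun k => KG k - ∑' t : Fin (d + 1) → ℤ, fG (z + (M k : ℤ) • t)) atTop (𝓝 0))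
    (hlaw : ∀ k, KN k = KF k + KG k) :
    fN z = fF z + fG z := by
  have pN := (tendsto_tsum_translate_smul hfN z).comp hM
  have pF := (tendsto_tsum_translate_smul hfF z).comp hM
  have pG := (tendsto_tsum_translate_smul hfG z).comp hM
  have hN : Tendsto KN atTop (𝓝 (fN z)) := by
    have h := hKN.add pN
    simp only [Function.comp_def, sub_add_cancel, zero_add] at h
    exact h
  have hF : Tendsto KF atTop (𝓝 (fF z)) := by
    have h := hKF.add pF
    simp only [Function.comp_def, sub_add_cancel, zero_add] at h
    exact h
  have hG : Tendsto KG atTop (𝓝 (fG z)) := by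
    have h := hKG.add pG
    simp only [Function.comp_def, sub_add_cancel, zero_add] at h
    exact h
  have hN' : Tendsto KN atTop (𝓝 (fF z + fG z)) := (hF.add hG).congr fun k => by simp only [hlaw k]
  exact tendsto_nhds_unique hN hN'

end Cubic

end Summit.QuantumFields.BalabanUV.Beta.FP.KernelLawDeperiodised

end
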